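import Mathlib

/-!
# Conjecture N (hodge-weil ladder, GAPS G51b), format (5,3): THE PURITY-LINE FORM OF THE REDUCED SYSTEM, ANY NUMBER OF FREE ROOTS

Prover 2, generation 23 (note `run/shared/lean/b2b/hodge-weil/b2b-hweil-pv2-g23/CROSSPLUS2-G23.md`). Generation 22 (`…CrossPlusOne*`,
note `CROSSPLUS1-G22.md` ADDENDUM K.1) wrote the real Conjecture-N functional of a centred pure configuration 'cross + k free roots' in
corner coordinates about the vertex `(As, us)` through the aggregates `X, M` (first corner moments), `D⁺, D⁻` (signed second),
`C₃⁺, C₃⁻` (unsigned third) — all INCLUDING the free roots — and the free-root sums `E = Σ εᵢeᵢ`, `Φ₀ = Σ εᵢeᵢddᵢ`, `Ψ₀ = Σ εᵢeᵢddᵢ²`,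
`Sab = Σ eᵢ(aᵢ+bᵢ)` (`eᵢ = aᵢbᵢ` the product of the corner distances of free root `i`, `ddᵢ` its charge offset from `us`, `εᵢ = ±1` its type):
`S = D⁺ + D⁻ − (X−M)²/2 − 2E`, `Mo = us·T + D⁺ − D⁻` (`T = X + M`, `2us = M − X`), `G = Q₂ + Q₄ = Mo² + (S/2)T² − S² − 2S·us² − 12Ψ + 2SE`
(`Ψ = us²E + 2usΦ₀ + Ψ₀`), `K = P4 − P1 = 2us·S + T·Mo − 4(usE + Φ₀)`, `P4 = 2us³ + 3us²(X−M) + 3us(D⁺+D⁻−2E) + C₃⁺ − C₃⁻ − 3Φ₀`,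
`P2 = As·S + us²T + 2us(D⁺−D⁻) + C₃⁺ + C₃⁻ − Sab` (`2As = −T`). THIS FILE records, as identities in these thirteen symbols (so valid for every
number and type of free roots), the structure found by generation 23:
* `K_aggregate` : `K = 2M·D⁺ − 2X·D⁻ + 4XM·us − 8us·E − 4Φ₀` — purity (P1) is LINEAR in the second moments;
* `C3p_of_purity`, `C3m_of_purity` : `P2 = P4 = 0` determine the cubic sums: `2C₃⁺ = (3X−2M)D⁺ + X·D⁻ − 4X·us² + E(6us−T) + Sab + 3Φ₀` and its mirror;
* `G_purity_line_form` : `T²·G = −4XM·S² + (2XM·T² + 2T²E − 16us·Φ)·S + 16Φ² − 12T²Ψ + q·K` (`Φ = usE + Φ₀`) with an explicit cofactor `q` —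
  so ON THE PURITY LINE `{K = 0}`, for fixed first moments and free roots, `G` IS A CONCAVE QUADRATIC IN THE SINGLE VARIABLE `S`
  (the second moments enter only through `S`): `T²G = −4XM(S − S₋)(S − S₊)`, and Conjecture N on the stratum reads `S₋ ≤ S ≤ S₊`;
* `M_of_H_data`, `S_of_H_data` : on the pure locus the V-axis first moment and `S` are SLAVED TO THE H-AXIS DATA:
  `M·(X² − D⁺) = 2C₃⁺ + X³ − 3X·D⁺ + 2XE − Sab − Φ₀`, `X·S = 2C₃⁺ + 4us·D⁺ + 2X·us² − 4usE − Sab − 3Φ₀` (and mirrors `X_of_V_data`, `S_of_V_data`).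
For `k = 0` these are generation 9's null-cone formulas (`G = 2XM·S(T²−2S)/T²`), for `k = 1` generation 22's piece relations
(`X² − D⁺ = X1·w`, `W₂`). Pure algebra (`ring` / `linear_combination`); nothing here is a case of HC, a rung or a door edge; no statement of
Markman's papers is used; COUNT of record unchanged. New cell result ⇒ Summits/.
-/

set_option linter.dupNamespace false

namespace Summit.HodgeConjecture.HodgeConjecture.WeilClassTestFormatFiveThreePurityLineForm

/-- (P1) in aggregate form: `K = P4 − P1 = 2us·S + T·Mo − 4(usE + Φ₀)` equals `2M·D⁺ − 2X·D⁻ + 4XM·us − 8us·E − 4Φ₀` — linear in `D⁺, D⁻`. -/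
theorem K_aggregate (X M Dp Dm E Φ₀ us : ℝ) (hus : 2 * us = M - X) :
    2 * us * (Dp + Dm - (X - M) ^ 2 / 2 - 2 * E) + (X + M) * (us * (X + M) + Dp - Dm) - 4 * (us * E + Φ₀)
      = 2 * M * Dp - 2 * X * Dm + 4 * X * M * us - 8 * us * E - 4 * Φ₀ := by
  have hus' : us = (M - X) / 2 := by linarith
  subst hus'
  ring

/-- `P2 = P4 = 0` determine the unsigned cubic corner sum of the H-axis: `2C₃⁺ = (3X−2M)D⁺ + X·D⁻ − 4X·us² + E(6us − T) + Sab + 3Φ₀`. -/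
theorem C3p_of_purity (X M Dp Dm Cp Cm E Φ₀ Sab us As : ℝ) (hus : 2 * us = M - X) (hAs : 2 * As = -(X + M))
    (hP4 : 2 * us ^ 3 + 3 * us ^ 2 * (X - M) + 3 * us * (Dp + Dm - 2 * E) + Cp - Cm - 3 * Φ₀ = 0)
    (hP2 : As * (Dp + Dm - (X - M) ^ 2 / 2 - 2 * E) + us ^ 2 * (X + M) + 2 * us * (Dp - Dm) + Cp + Cm - Sab = 0) :
    2 * Cp = (3 * X - 2 * M) * Dp + X * Dm - 4 * X * us ^ 2 + E * (6 * us - (X + M)) + Sab + 3 * Φ₀ := by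
  have hus' : us = (M - X) / 2 := by linarith
  have hAs' : As = -(X + M) / 2 := by linarith
  subst hus' hAs'
  linear_combination hP4 + hP2

/-- Mirror: `2C₃⁻ = (3M−2X)D⁻ + M·D⁺ − 4M·us² − E(6us + T) + Sab − 3Φ₀`. -/
theorem C3m_of_purity (X M Dp Dm Cp Cm E Φ₀ Sab us As : ℝ) (hus : 2 * us = M - X) (hAs : 2 * As = -(X + M))
    (hP4 : 2 * us ^ 3 + 3 * us ^ 2 * (X - M) + 3 * us * (Dp + Dm - 2 * E) + Cp - Cm - 3 * Φ₀ = 0)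
    (hP2 : As * (Dp + Dm - (X - M) ^ 2 / 2 - 2 * E) + us ^ 2 * (X + M) + 2 * us * (Dp - Dm) + Cp + Cm - Sab = 0) :
    2 * Cm = (3 * M - 2 * X) * Dm + M * Dp - 4 * M * us ^ 2 - E * (6 * us + (X + M)) + Sab - 3 * Φ₀ := by
  have hus' : us = (M - X) / 2 := by linarith
  have hAs' : As = -(X + M) / 2 := by linarith
  subst hus' hAs'
  linear_combination hP2 - hP4

/-- **THE PURITY-LINE FORM OF `G`.** With `S, Mo, Φ = usE + Φ₀, Ψ = us²E + 2usΦ₀ + Ψ₀, G, K` as in the module docstring,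
`T²·G = (−4XM·S² + (2XM·T² + 2T²E − 16us·Φ)·S + 16Φ² − 12T²Ψ) + q·K` with
`q = 2X·D⁺ − 2M·D⁻ + (M−X)(M²+X²) + 4(M−X)E + 4Φ₀`: on `{K = 0}` the second moments enter `G` only through `S`, and `G` is a concave
quadratic in `S` with leading coefficient `−4XM/T²`. -/
theorem G_purity_line_form (X M Dp Dm E Φ₀ Ψ₀ us : ℝ) (hus : 2 * us = M - X) :
    (X + M) ^ 2 * ((us * (X + M) + Dp - Dm) ^ 2 + ((Dp + Dm - (X - M) ^ 2 / 2 - 2 * E) / 2) * (X + M) ^ 2 - (Dp + Dm - (X - M) ^ 2 / 2 - 2 * E) ^ 2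
        - 2 * (Dp + Dm - (X - M) ^ 2 / 2 - 2 * E) * us ^ 2 - 12 * (us ^ 2 * E + 2 * us * Φ₀ + Ψ₀) + 2 * (Dp + Dm - (X - M) ^ 2 / 2 - 2 * E) * E)
      = (-4 * X * M * (Dp + Dm - (X - M) ^ 2 / 2 - 2 * E) ^ 2
          + (2 * X * M * (X + M) ^ 2 + 2 * (X + M) ^ 2 * E - 16 * us * (us * E + Φ₀)) * (Dp + Dm - (X - M) ^ 2 / 2 - 2 * E)
          + 16 * (us * E + Φ₀) ^ 2 - 12 * (X + M) ^ 2 * (us ^ 2 * E + 2 * us * Φ₀ + Ψ₀))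
        + (2 * X * Dp - 2 * M * Dm + (M - X) * (M ^ 2 + X ^ 2) + 4 * (M - X) * E + 4 * Φ₀)
          * (2 * us * (Dp + Dm - (X - M) ^ 2 / 2 - 2 * E) + (X + M) * (us * (X + M) + Dp - Dm) - 4 * (us * E + Φ₀)) := by
  have hus' : us = (M - X) / 2 := by linarith
  subst hus'
  ring

/-- On the purity line: if `K = 0` then `T²·G = −4XM·S² + (2XM·T² + 2T²E − 16us·Φ)·S + 16Φ² − 12T²Ψ`. -/
theorem G_on_purity_line (X M Dp Dm E Φ₀ Ψ₀ us : ℝ) (hus : 2 * us = M - X)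
    (hK : 2 * us * (Dp + Dm - (X - M) ^ 2 / 2 - 2 * E) + (X + M) * (us * (X + M) + Dp - Dm) - 4 * (us * E + Φ₀) = 0) :
    (X + M) ^ 2 * ((us * (X + M) + Dp - Dm) ^ 2 + ((Dp + Dm - (X - M) ^ 2 / 2 - 2 * E) / 2) * (X + M) ^ 2 - (Dp + Dm - (X - M) ^ 2 / 2 - 2 * E) ^ 2
        - 2 * (Dp + Dm - (X - M) ^ 2 / 2 - 2 * E) * us ^ 2 - 12 * (us ^ 2 * E + 2 * us * Φ₀ + Ψ₀) + 2 * (Dp + Dm - (X - M) ^ 2 / 2 - 2 * E) * E)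
      = -4 * X * M * (Dp + Dm - (X - M) ^ 2 / 2 - 2 * E) ^ 2
          + (2 * X * M * (X + M) ^ 2 + 2 * (X + M) ^ 2 * E - 16 * us * (us * E + Φ₀)) * (Dp + Dm - (X - M) ^ 2 / 2 - 2 * E)
          + 16 * (us * E + Φ₀) ^ 2 - 12 * (X + M) ^ 2 * (us ^ 2 * E + 2 * us * Φ₀ + Ψ₀) := by
  rw [G_purity_line_form X M Dp Dm E Φ₀ Ψ₀ us hus, hK, mul_zero, add_zero]

/-- **The V-axis first moment is slaved to the H-axis data.** On the pure locus (`P1 = P2 = P4 = 0`, i.e. `K = 0` and the two cubic-sum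
relations), `M·(X² − D⁺) = 2C₃⁺ + X³ − 3X·D⁺ + 2XE − Sab − Φ₀`. (For a cross with one free E-root this is generation 22's `w·M1 = (X1−t)·r`;
`X² − D⁺ ≥ 0` whenever the H-axis corner measure and the free roots' H-distances are nonnegative and `(Σ masses)² ≥ Σ mass·position`.) -/
theorem M_of_H_data (X M Dp Dm Cp Cm E Φ₀ Sab us As : ℝ) (hus : 2 * us = M - X) (hAs : 2 * As = -(X + M))
    (hP4 : 2 * us ^ 3 + 3 * us ^ 2 * (X - M) + 3 * us * (Dp + Dm - 2 * E) + Cp - Cm - 3 * Φ₀ = 0)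
    (hP2 : As * (Dp + Dm - (X - M) ^ 2 / 2 - 2 * E) + us ^ 2 * (X + M) + 2 * us * (Dp - Dm) + Cp + Cm - Sab = 0)
    (hK : 2 * us * (Dp + Dm - (X - M) ^ 2 / 2 - 2 * E) + (X + M) * (us * (X + M) + Dp - Dm) - 4 * (us * E + Φ₀) = 0) :
    M * (X ^ 2 - Dp) = 2 * Cp + X ^ 3 - 3 * X * Dp + 2 * X * E - Sab - Φ₀ := by
  have hus' : us = (M - X) / 2 := by linarith
  have hAs' : As = -(X + M) / 2 := by linarith
  subst hus' hAs'
  linear_combination (1 / 2 : ℝ) * hK - hP4 - hP2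

/-- Mirror: `X·(M² − D⁻) = 2C₃⁻ + M³ − 3M·D⁻ + 2ME − Sab + Φ₀` on the pure locus. -/
theorem X_of_V_data (X M Dp Dm Cp Cm E Φ₀ Sab us As : ℝ) (hus : 2 * us = M - X) (hAs : 2 * As = -(X + M))
    (hP4 : 2 * us ^ 3 + 3 * us ^ 2 * (X - M) + 3 * us * (Dp + Dm - 2 * E) + Cp - Cm - 3 * Φ₀ = 0)
    (hP2 : As * (Dp + Dm - (X - M) ^ 2 / 2 - 2 * E) + us ^ 2 * (X + M) + 2 * us * (Dp - Dm) + Cp + Cm - Sab = 0)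
    (hK : 2 * us * (Dp + Dm - (X - M) ^ 2 / 2 - 2 * E) + (X + M) * (us * (X + M) + Dp - Dm) - 4 * (us * E + Φ₀) = 0) :
    X * (M ^ 2 - Dm) = 2 * Cm + M ^ 3 - 3 * M * Dm + 2 * M * E - Sab + Φ₀ := by
  have hus' : us = (M - X) / 2 := by linarith
  have hAs' : As = -(X + M) / 2 := by linarith
  subst hus' hAs'
  linear_combination (-1 / 2 : ℝ) * hK + hP4 - hP2

/-- **`S` is slaved to the H-axis data.** On the pure locus (`P2 = P4 = 0`), `X·S = 2C₃⁺ + 4us·D⁺ + 2X·us² − 4usE − Sab − 3Φ₀`. -/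
theorem S_of_H_data (X M Dp Dm Cp Cm E Φ₀ Sab us As : ℝ) (hus : 2 * us = M - X) (hAs : 2 * As = -(X + M))
    (hP4 : 2 * us ^ 3 + 3 * us ^ 2 * (X - M) + 3 * us * (Dp + Dm - 2 * E) + Cp - Cm - 3 * Φ₀ = 0)
    (hP2 : As * (Dp + Dm - (X - M) ^ 2 / 2 - 2 * E) + us ^ 2 * (X + M) + 2 * us * (Dp - Dm) + Cp + Cm - Sab = 0) :
    X * (Dp + Dm - (X - M) ^ 2 / 2 - 2 * E) = 2 * Cp + 4 * us * Dp + 2 * X * us ^ 2 - 4 * us * E - Sab - 3 * Φ₀ := by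
  have hus' : us = (M - X) / 2 := by linarith
  have hAs' : As = -(X + M) / 2 := by linarith
  subst hus' hAs'
  linear_combination (-1 : ℝ) * hP4 - hP2

/-- Mirror: `M·S = 2C₃⁻ − 4us·D⁻ + 2M·us² + 4usE − Sab + 3Φ₀` on the pure locus. -/
theorem S_of_V_data (X M Dp Dm Cp Cm E Φ₀ Sab us As : ℝ) (hus : 2 * us = M - X) (hAs : 2 * As = -(X + M))
    (hP4 : 2 * us ^ 3 + 3 * us ^ 2 * (X - M) + 3 * us * (Dp + Dm - 2 * E) + Cp - Cm - 3 * Φ₀ = 0)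
    (hP2 : As * (Dp + Dm - (X - M) ^ 2 / 2 - 2 * E) + us ^ 2 * (X + M) + 2 * us * (Dp - Dm) + Cp + Cm - Sab = 0) :
    M * (Dp + Dm - (X - M) ^ 2 / 2 - 2 * E) = 2 * Cm - 4 * us * Dm + 2 * M * us ^ 2 + 4 * us * E - Sab + 3 * Φ₀ := by
  have hus' : us = (M - X) / 2 := by linarith
  have hAs' : As = -(X + M) / 2 := by linarith
  subst hus' hAs'
  linear_combination hP4 - hP2

end Summit.HodgeConjecture.HodgeConjecture.WeilClassTestFormatFiveThreePurityLineForm
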